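import Summits.AnomalousDissipation.AnomalousDissipation.Theses.ImpulseGrid
import Summits.AnomalousDissipation.AnomalousDissipation.Theorems.MarginalStabilityChainChainRealisationStubLoudOfContrast
import Literature.Analysis.FluidPDE.TorusClassicalLerayHopfProofs
import Literature.Analysis.FunctionSpaces.TorusClassicalNSGluing
import HarnessLib

/-!
# Stub `stub_regularDriftStatesSuffice` of the line `Sketch`
# (crux `ImpulseGrid.BoundedEnergyNoLeakGrid`, stmt-AnomalousDissipation-14350)

Sorry-free discharge of the registered stub `stub_regularDriftStatesSuffice` of the lead's skeleton (v4)
for the crux `ImpulseGrid.BoundedEnergyNoLeakGrid` (line `Sketch`): the **bookkeeping transfer** showing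
that, at a fixed grid design `(Φ, G, c)`, a vanishing-viscosity family of ETERNAL CLASSICAL solutions
`(u_j, p_j)` of the Navier–Stokes system on `ℝ × T³` forced by the steady force `f := Φ • G`, with drift
datum `∫ u_j 0 = c e₀`, a PER-`j` forward kinetic-energy cap `kineticEnergy (u_j t) ≤ C_j` (`t ≥ 0`) and
`j`-uniformly bounded MEAN energy `meanEnergy (u j) ≤ E`, witnesses every clause of the crux with
`u₀ j := u_j 0` (same `ν`, same `u`):

* global Leray–Hopf: `Torus.IsClassicalNSSolutionOn.isGlobalLerayHopf` (Robinson–Rodrigo–Sadowski 2016,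
  Thm. 6.5);
* per-`j` sup-energy bound, drift datum and the uniform mean-energy bound: copied;
* NO LEAKAGE (indeed mean energy EQUALITY `⟨ν‖∇u‖²⟩ = ⟨(f, u)⟩`): the in-tree budget lemma
  `ChainRealisation.SeparatrixFluxPinning.meanDissipation_eq_longTimeAvgSup_inner`
  (`Theorems/MarginalStabilityChainChainRealisationStubLoudOfContrast.lean`, time set `[0, ∞)`;
  Doering–Foias 2002 §2 (2.4)), applied to the restriction of the eternal solution to `[0, ∞)`
  (`Torus.IsClassicalNSSolutionOn.mono`) under the `L²` cap `∫‖u_j(t)‖² = 2·kineticEnergy (u_j t) ≤ 2C_j`.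

This is the weakest-regularity sister of the landed `stub_classicalWitnessReduction`
(`Theorems/ImpulseGridBoundedEnergyNoLeakGridStubClassicalWitnessReduction.lean`, uniform cap); of the ten
design hypotheses on `(Φ, G, c)` only the smoothness of `Φ • G` is used (for `‖f‖₂² < ∞`).

References: C. R. Doering, C. Foias, *Energy dissipation in body-forced turbulence*, J. Fluid Mech. 467 (2002)
§2; J. C. Robinson, J. L. Rodrigo, W. Sadowski, *The Three-Dimensional Navier–Stokes Equations* (CUP 2016)
Thm. 6.5.
-/

set_option linter.dupNamespace false

noncomputable section

open MeasureTheory Filter Set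
open scoped InnerProductSpace
open Literature.Analysis.FunctionSpaces Literature.Analysis.FunctionSpaces.Torus
open Literature.Analysis.FluidPDE Literature.Analysis.FluidPDE.Torus
open Summit.AnomalousDissipation.AnomalousDissipation.Theorems.ChainRealisation.SeparatrixFluxPinning

namespace Summit.AnomalousDissipation.AnomalousDissipation.Theorems.BoundedEnergyNoLeakGrid

/-- Local notation (verbatim from the lead's skeleton): the torus `T³`. -/
local notation "𝕋³" => UnitAddTorus (Fin 3)
/-- Local notation (verbatim from the lead's skeleton): velocity values. -/
local notation "E³" => EuclideanSpace ℝ (Fin 3)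

/-- **No Leray–Hopf leakage for an eternal classical solution with a forward kinetic-energy cap**
(file-private form of the landed `longTimeAvgSup_inner_le_meanDissipation_of_kineticEnergy_le`): for a
classical solution of the forced Navier–Stokes system on all of `ℝ × T^d` with a steady smooth force `f`
and `kineticEnergy (u t) ≤ C` for `t ≥ 0`, `limsup_T T⁻¹∫₀ᵀ ∫⟪f, u(t)⟫ dt ≤ ⟨ν‖∇u‖₂²⟩` — with equality,
by the budget lemma `meanDissipation_eq_longTimeAvgSup_inner` on the restriction to `[0, ∞)`
(`Torus.IsClassicalNSSolutionOn.mono`) and the `L²` cap `∫‖u(t)‖² = 2·kineticEnergy (u t) ≤ 2C`. -/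
private theorem noLeak_of_cap {d : Type*} [Fintype d] [DecidableEq d] {ν : ℝ}
    {f : UnitAddTorus d → EuclideanSpace ℝ d} {u : ℝ → UnitAddTorus d → EuclideanSpace ℝ d}
    {p : ℝ → UnitAddTorus d → ℝ} (h : IsClassicalNSSolutionOn univ ν (fun _ => f) u p) (hf : IsSmooth f)
    {C : ℝ} (hC : ∀ t : ℝ, 0 ≤ t → kineticEnergy (u t) ≤ C) :
    longTimeAvgSup (fun t => ∫ x, ⟪f x, u t x⟫_ℝ) ≤ meanDissipation ν u := by
  have h2 : ∀ t : ℝ, 0 ≤ t → ∫ x, ‖u t x‖ ^ 2 ≤ 2 * C := fun t ht => by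
    have h1 := hC t ht
    unfold kineticEnergy at h1
    linarith
  exact (meanDissipation_eq_longTimeAvgSup_inner (h.mono (subset_univ _) (uniqueDiffOn_Ici 0)) hf h2).symm.le

/-- **stub_regularDriftStatesSuffice** (registered stub of the line `Sketch`, crux
`ImpulseGrid.BoundedEnergyNoLeakGrid`).  At a fixed grid design, a vanishing-viscosity family of eternal
classical solutions forced by `Φ • G`, with drift datum `∫ u_j 0 = c e₀`, a per-`j` forward kinetic-energy
cap and `j`-uniformly bounded mean energy, witnesses the crux's conclusion with `u₀ j := u_j 0`: global
Leray–Hopf (`Torus.IsClassicalNSSolutionOn.isGlobalLerayHopf`), the per-`j` cap, the datum and the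
mean-energy bound are copied, and no leakage follows from the exact energy budget of classical solutions
under the per-`j` cap (`meanDissipation_eq_longTimeAvgSup_inner`).  Of the ten design hypotheses only the
smoothness of `Φ • G` is used. -/
theorem stub_regularDriftStatesSuffice :
    ∀ (Φ : 𝕋³ → ℝ) (G : 𝕋³ → E³) (c : ℝ), IsSmooth Φ → IsSmooth G →
    (∀ (s : UnitAddCircle) x, Φ (x + Pi.single (1 : Fin 3) s) = Φ x ∧ Φ (x + Pi.single (2 : Fin 3) s) = Φ x) →
    (∫ x, Φ x = 1) → (∀ (s : UnitAddCircle) x, G (x + Pi.single (0 : Fin 3) s) = G x) → (∀ x, G x 0 = 0) →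
    IsSmooth (fun x => Φ x • G x) → IsDivFree (fun x => Φ x • G x) → HasZeroMean (fun x => Φ x • G x) →
    0 < c →
    (∃ (ν : ℕ → ℝ) (u : ℕ → ℝ → 𝕋³ → E³) (p : ℕ → ℝ → 𝕋³ → ℝ),
      (∀ j, 0 < ν j) ∧ Tendsto ν atTop (nhds 0) ∧
      (∀ j, IsClassicalNSSolutionOn Set.univ (ν j) (fun _ => fun x => Φ x • G x) (u j) (p j)) ∧
      (∀ j, ∫ x, u j 0 x = c • EuclideanSpace.single (0 : Fin 3) (1 : ℝ)) ∧
      (∀ j, ∃ C : ℝ, ∀ t : ℝ, 0 ≤ t → kineticEnergy (u j t) ≤ C) ∧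
      (∃ E : ℝ, ∀ j, meanEnergy (u j) ≤ E)) →
    ∃ (ν : ℕ → ℝ) (u₀ : ℕ → 𝕋³ → E³) (u : ℕ → ℝ → 𝕋³ → E³),
      (∀ j, 0 < ν j) ∧ Filter.Tendsto ν Filter.atTop (nhds 0) ∧
      (∀ j, IsGlobalLerayHopf (ν j) (fun _ => fun x => Φ x • G x) (u₀ j) (u j)) ∧
      (∀ j, ∃ C : ℝ, ∀ t : ℝ, 0 ≤ t → kineticEnergy (u j t) ≤ C) ∧
      (∀ j, ∫ x, u₀ j x = c • EuclideanSpace.single 0 1) ∧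
      (∃ E : ℝ, ∀ j, meanEnergy (u j) ≤ E) ∧
      (∀ j, longTimeAvgSup (fun t => ∫ x, inner ℝ (Φ x • G x) (u j t x)) ≤ meanDissipation (ν j) (u j)) := by
  intro Φ G c _ _ _ _ _ _ hfs _ _ _ hfam
  obtain ⟨ν, u, p, hν, hν0, hcl, hdat, hcap, hE⟩ := hfam
  refine ⟨ν, fun j => u j 0, u, hν, hν0, fun j => (hcl j).isGlobalLerayHopf, hcap, hdat, hE, fun j => ?_⟩
  obtain ⟨C, hC⟩ := hcap j
  exact noLeak_of_cap (hcl j) hfs hC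

end Summit.AnomalousDissipation.AnomalousDissipation.Theorems.BoundedEnergyNoLeakGrid

end
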